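import Literature.Computability.AlgebraicComplexity.HI16DetSkewCircuitProofs
import HarnessLib

/-!
# Register programs compile to WELL-FORMED circuits

A companion to `ArithCircuit.RegProg` (`HI16DetSkewCircuitProofs.lean`): the compiled circuit of a
well-ranked register program whose output reads registers of the program is well formed in the
sense of `ArithCircuit.WellFormed` (every gate reads earlier positions, the output reads positions
`< size`) — the guard required by the corrected `wsComplexity` / `skewComplexity`
(`BLMW11KroneckerApproximation.lean`, erratum A14). Theorem only. [cite: Burgisser2000, Def. 2.1]
-/

namespace Literature.Computability.AlgebraicComplexity

namespace ArithCircuit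

namespace RegProg

universe u v w

variable {k : Type u} {σ : Type v} {ρ : Type w} [DecidableEq ρ] (R : RegProg k σ ρ)

/-- The first index of the `i`-th entry is at most `i`. [folklore] -/
private theorem idxOf_getElem_le' (l : List ρ) (i : ℕ) (hi : i < l.length) :
    l.idxOf l[i] ≤ i := by
  induction l generalizing i with
  | nil => simp at hi
  | cons x xs ih =>
    cases i with
    | zero => simp
    | succ j =>
      have hj : j < xs.length := by simpa using hi
      simp only [List.getElem_cons_succ, List.idxOf_cons]
      cases (x == xs[j]) <;> simp [ih j hj]

/-- A translated operand refers below `n` as soon as every register it reads sits at a position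
`< n`. [cite: Burgisser2000, Def. 2.1] -/
theorem refsBelow_tr {n : ℕ} (u : ROperand k σ ρ) (h : ∀ r' ∈ u.reads, R.pos r' < n) :
    (u.tr R.pos).RefsBelow n := by
  cases u with
  | var i => trivial
  | const c => trivial
  | reg r' => exact h r' (by simp)

/-- **The compiled circuit of a well-ranked register program is well formed**: gate number `i`
(the `i`-th register in rank order) reads only registers of smaller rank, which sit at positions
`< i`; the output reads registers of the program, at positions `< size`.
[cite: Burgisser2000, Def. 2.1] -/
theorem wellFormed_compile (hW : R.WellRanked) (hout : ∀ r' ∈ R.output.reads, r' ∈ R.regs) :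
    R.compile.WellFormed := by
  refine ⟨fun i g hg u hu => ?_, ?_⟩
  · have hi : i < R.sorted.length := by
      have h := (List.getElem?_eq_some_iff.1 hg).1
      simpa [compile] using h
    have hmem : R.sorted[i] ∈ R.regs := (mem_sorted R).1 (List.getElem_mem hi)
    have hgi : g = (R.gateOf R.sorted[i]).tr R.pos := by
      have h := List.getElem?_eq_some_iff.1 hg
      obtain ⟨h1, h2⟩ := h
      rw [← h2]
      simp [compile, List.getElem_map]
    -- every register read by gate `i` sits at an earlier position
    have hreads : ∀ r' ∈ (R.gateOf R.sorted[i]).reads, R.pos r' < i := by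
      intro r' hr'
      obtain ⟨hr'mem, hrank⟩ := hW _ hmem r' hr'
      exact (R.pos_lt_pos_of_rank_lt hmem hr'mem hrank).trans_le
        (idxOf_getElem_le' R.sorted i hi)
    subst hgi
    rcases hgo : R.gateOf R.sorted[i] with args | args
    · rw [hgo] at hu hreads
      simp only [RGate.tr, Gate.args, List.map_map, List.mem_map, Function.comp_apply] at hu
      obtain ⟨a, ha, rfl⟩ := hu
      refine refsBelow_tr R a.2 fun r' hr' => hreads r' ?_
      simp only [RGate.reads, List.mem_flatMap]
      exact ⟨a, ha, hr'⟩
    · rw [hgo] at hu hreads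
      simp only [RGate.tr, Gate.args, List.mem_map] at hu
      obtain ⟨u', hu', rfl⟩ := hu
      refine refsBelow_tr R u' fun r' hr' => hreads r' ?_
      simp only [RGate.reads, List.mem_flatMap]
      exact ⟨u', hu', hr'⟩
  · change (R.output.tr R.pos).RefsBelow R.compile.size
    refine refsBelow_tr R R.output fun r' hr' => ?_
    rw [size_compile, ← length_sorted]
    exact R.pos_lt_length (hout r' hr')

end RegProg

end ArithCircuit

end Literature.Computability.AlgebraicComplexity
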